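import Literature.AlgebraicGeometry.ShimuraVarieties.UnitaryAuxiliaryPeriodEigenrows
import Literature.AlgebraicGeometry.ModuliOfAbelianVarieties.SiegelSpaceLeftEigenrows
import Literature.AlgebraicGeometry.ModuliOfAbelianVarieties.SiegelShimuraSet
import Literature.NumberTheory.ModularForms.SiegelSymplecticVolume
import Literature.NumberTheory.ComplexMultiplication.CMTypeLattice
import Literature.AlgebraicGeometry.ShimuraVarieties.UnitaryBallAutomorphicForms
import Mathlib.Analysis.Matrix.Normed
import HarnessLib

/-!
# The period chart of `J_{β,Φ}`: `z ↦ Z(γ J_{β,Φ}(z) γ⁻¹) ∈ 𝔥_g` is holomorphic on `𝔹²` with injective differential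

Topic `AlgebraicGeometry/ShimuraVarieties`; namespace `Literature.AlgebraicGeometry.ShimuraVarieties.UnitaryCanonicalModel.Aux`.
KEY TARGET 1 of the HDel line (cell hodgecm-mathlib, crux stmt-HodgeConjecture-24835): the ONE analytic input `hP` of the closers
★ `S2Imm_of_periodChart` (S2imm) and `stub_S2pair_holds` (S2pair), in exactly their hypothesis shape (`periodChart`).

Route («left eigenrows»): with the census ★ `UnitaryAuxiliaryPeriodEigenrows` of `g = 4·#Φ` linearly independent left
`+i`-eigenrows of `res(B_z)_ℂ`, AFFINE in `u = z ∈ ℂ²`, the matrix `R(u) = S(u)·Q_ℂ·γ⁻¹` has independent rows and satisfies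
`R(u)·(γ J(z) γ⁻¹)_ℂ = i·R(u)` (`J = P_ℝ·res(B_z)·Q_ℝ`, ★ `auxRep`; `Q·P = 1`); hence ★ `siegelOfJ_eq_of_leftEigenrows` gives
`Z(γ J(z) γ⁻¹) = Δ·R₂(u)⁻¹·R₁(u)` — a RATIONAL function of `u`, holomorphic where `det R₂ ≠ 0`, i.e. on the whole ball.  The
injectivity of the differential: if `dZ_u(δ) = 0` then, differentiating `R₁ = R₂·Δ⁻¹·Z` (★ `toCols₁_eq_toCols₂_mul`), the
derivative `dR(δ)` is again a matrix of left `+i`-eigenrows of `(γJγ⁻¹)_ℂ`, so its `(ρ₀, inr k)`-row `δ_k·(0 | -e₂T⁻¹) ⊗ r_{ρ₀}`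
(`ρ₀ ∈ Φ` over `τ`) is a `+i`-eigenrow of `res(B_z)_ℂ`, which forces `δ_k·(e₂·reflJ(w) - e₂) = 0`, i.e. `δ_k = 0`.

Main results: `card_index_eq` (`4·#Φ = g`), `periodRows`/`periodRows_mul_conj` (`R·J'_ℂ = i·R`), `periodRows_vecMul_injective`,
`periodZ_eq_siegelOfJ`, `differentiableOn_periodCoord`, `injective_fderiv_periodCoord`, and the export **`periodChart`**.

## References
* [Deligne1971TravauxShimura] P. Deligne, *Travaux de Shimura*, 1.14–1.15 (the embedding of hermitian symmetric domains attached
  to a morphism of Shimura data is holomorphic), 5.4.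
* [Deligne1979ShimuraVarieties] P. Deligne, *Variétés de Shimura*, Prop. 2.3.10.
* [Lange2023AbelianVarietiesComplex] H. Lange, *Abelian Varieties over the Complex Numbers*, §7.1.2 (7.3), Lemma 7.1.6.
-/

set_option autoImplicit false

noncomputable section

open Matrix NumberField Complex
open scoped TensorProduct ComplexConjugate Classical Matrix.Norms.Elementwise Topology

namespace Literature.AlgebraicGeometry.ShimuraVarieties

namespace UnitaryCanonicalModel

namespace Aux

open Literature.AlgebraicGeometry.ModuliOfAbelianVarieties
open Literature.AlgebraicGeometry.ModuliOfAbelianVarieties.SiegelModuli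
open Literature.AlgebraicGeometry.Motives (CMType)
open Literature.Geometry.ComplexHyperbolic
open Literature.NumberTheory.Automorphic (siegelUpperHalfSpace mem_siegelUpperHalfSpace_iff)
open Literature.NumberTheory.ModularForms.SiegelUpperHalfSpace (siegelUpperHalfSpaceCoord coordCLE
  mem_siegelUpperHalfSpaceCoord_iff)
open Literature.LinearAlgebra.Matrix (symmetricSubmodule)
open Literature.NumberTheory.Automorphic (formCongr)
open scoped ComplexOrder

variable {L : Type} [Field L] (M : Type) [Field M] [NumberField M] [IsCMField M] {j : L →+* M}
  {H : Matrix (Fin 3) (Fin 3) L} {ξ₀ ξ : M} {g : ℕ} {δ : Fin g → ℕ}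
  (F : SymplecticFrame M j H ξ₀ ξ g δ) (Φ : CMType M) (τ : L →+* ℂ) (T : GL (Fin 3) ℂ)

/-! ### §1. `4·#Φ = g` and the reindexing of the census -/

include F in
/-- **`4·#Φ = g`**: the frame `β : M^{1⊕3} ≃ ℚ^{g⊕g}` forces `2g = 4[M:ℚ]`, and `2·#Φ = [M:ℚ]` (★ `two_mul_card_eq_finrank`).
[cite: Deligne1979ShimuraVarieties, Prop. 2.3.10 (PDF p. 32)] -/
theorem card_index_eq : Fintype.card (Φ.1 × (Fin 1 ⊕ Fin 3)) = g := by
  have h1 : Module.finrank ℚ ((Fin 1 ⊕ Fin 3) → M) = Module.finrank ℚ (Fin g ⊕ Fin g → ℚ) := LinearEquiv.finrank_eq F.β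
  rw [Module.finrank_pi_fintype, Finset.sum_const, Finset.card_univ, smul_eq_mul,
    Module.finrank_fintype_fun_eq_card] at h1
  simp only [Fintype.card_sum, Fintype.card_fin] at h1
  have h2 := Literature.NumberTheory.ComplexMultiplication.CMTypeLattice.two_mul_card_eq_finrank Φ
  simp only [Fintype.card_prod, Fintype.card_sum, Fintype.card_fin]
  omega

/-- The reindexing of the census rows by `Fin g`. [cite: Deligne1979ShimuraVarieties, Prop. 2.3.10 (PDF p. 32)] -/
def rowEquiv : Φ.1 × (Fin 1 ⊕ Fin 3) ≃ Fin g :=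
  Fintype.equivFinOfCardEq (card_index_eq M F Φ)

/-! ### §2. The matrices `S(u)`, `R(u) = S(u)·Q_ℂ·γ⁻¹` and the eigen-relation `R·(γJγ⁻¹)_ℂ = i·R` -/

/-- **`S(u)`**: the `g` census rows at the parameter `u ∈ ℂ²`, as a `g × 4[M:ℚ]` complex matrix.
[cite: Deligne1979ShimuraVarieties, Prop. 2.3.10 (PDF p. 32)] -/
def censusMatrix (u : Fin 2 → ℂ) : Matrix (Fin g) ((Fin 1 ⊕ Fin 3) × Fin (Module.finrank ℚ M)) ℂ :=
  Matrix.of fun k => censusRow M Φ j τ T ((rowEquiv M F Φ).symm k) u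

/-- The complexified inverse frame matrix `Q_ℂ`. [cite: Deligne1979ShimuraVarieties, Prop. 2.3.10 (PDF p. 32)] -/
def frameQC : Matrix ((Fin 1 ⊕ Fin 3) × Fin (Module.finrank ℚ M)) (Fin g ⊕ Fin g) ℂ :=
  (frameQ F).map (algebraMap ℚ ℂ)

/-- The complexified frame matrix `P_ℂ`. [cite: Deligne1979ShimuraVarieties, Prop. 2.3.10 (PDF p. 32)] -/
def framePC : Matrix (Fin g ⊕ Fin g) ((Fin 1 ⊕ Fin 3) × Fin (Module.finrank ℚ M)) ℂ :=
  (frameP F).map (algebraMap ℚ ℂ)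

/-- `Q_ℂ P_ℂ = 1`. [cite: Deligne1979ShimuraVarieties, Prop. 2.3.10 (PDF p. 32)] -/
theorem frameQC_mul_framePC : frameQC M F * framePC M F = 1 := by
  rw [frameQC, framePC, ← Matrix.map_mul, frameQ_mul_frameP, Matrix.map_one _ (map_zero _) (map_one _)]

/-- `P_ℂ Q_ℂ = 1`. [cite: Deligne1979ShimuraVarieties, Prop. 2.3.10 (PDF p. 32)] -/
theorem framePC_mul_frameQC : framePC M F * frameQC M F = 1 := by
  rw [frameQC, framePC, ← Matrix.map_mul, frameP_mul_frameQ, Matrix.map_one _ (map_zero _) (map_one _)]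

/-- **`R(u) = S(u)·Q_ℂ·γ_ℂ⁻¹`** for a real similitude `γ`. [cite: Deligne1979ShimuraVarieties, Prop. 2.3.10 (PDF p. 32)] -/
def periodRows (γ : GL (Fin g ⊕ Fin g) ℝ) (u : Fin 2 → ℂ) : Matrix (Fin g) (Fin g ⊕ Fin g) ℂ :=
  censusMatrix M F Φ τ T u * frameQC M F * ((γ⁻¹ : GL (Fin g ⊕ Fin g) ℝ) : Matrix (Fin g ⊕ Fin g) (Fin g ⊕ Fin g) ℝ).map ((↑) : ℝ → ℂ)

/-- `R(u)·(γ_ℂ·P_ℂ) = S(u)`. [cite: Deligne1979ShimuraVarieties, Prop. 2.3.10 (PDF p. 32)] -/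
theorem periodRows_mul (γ : GL (Fin g ⊕ Fin g) ℝ) (u : Fin 2 → ℂ) :
    periodRows M F Φ τ T γ u * ((γ : Matrix (Fin g ⊕ Fin g) (Fin g ⊕ Fin g) ℝ).map ((↑) : ℝ → ℂ) * framePC M F) = censusMatrix M F Φ τ T u := by
  have hγ : ((γ⁻¹ : GL (Fin g ⊕ Fin g) ℝ) : Matrix (Fin g ⊕ Fin g) (Fin g ⊕ Fin g) ℝ).map ((↑) : ℝ → ℂ) * (γ : Matrix (Fin g ⊕ Fin g) (Fin g ⊕ Fin g) ℝ).map ((↑) : ℝ → ℂ) = 1 := by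
    rw [← Complex.coe_algebraMap, ← Matrix.map_mul, ← Units.val_mul, inv_mul_cancel, Units.val_one,
      Matrix.map_one _ (map_zero _) (map_one _)]
  rw [periodRows, Matrix.mul_assoc, Matrix.mul_assoc, ← Matrix.mul_assoc (((γ⁻¹ : GL (Fin g ⊕ Fin g) ℝ) : Matrix (Fin g ⊕ Fin g) (Fin g ⊕ Fin g) ℝ).map _),
    hγ, Matrix.one_mul, frameQC_mul_framePC, Matrix.mul_one]

/-- **The complexified `J_{β,Φ}(z)`**: `J(z)_ℂ = P_ℂ · res(B_z)_ℂ · Q_ℂ` (★ `auxRep` read over `ℂ`).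
[cite: Deligne1979ShimuraVarieties, Prop. 2.3.10 (PDF p. 32)] -/
theorem auxComplexStructure_map_ofReal (z : BallModel.Ball) :
    (auxComplexStructure F τ Φ T z).map ((↑) : ℝ → ℂ) =
      framePC M F * (resMatrix (Algebra.TensorProduct.basis ℝ (ratBasis M))
          (((blockGL (ℝ ⊗[ℚ] M) (iPhi M Φ, sPhi M j Φ τ T z) : GL (Fin 1 ⊕ Fin 3) (ℝ ⊗[ℚ] M)) :
            Matrix (Fin 1 ⊕ Fin 3) (Fin 1 ⊕ Fin 3) (ℝ ⊗[ℚ] M)))).map (algebraMap ℝ ℂ) * frameQC M F := by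
  have hmaps : ((algebraMap ℝ ℂ : ℝ → ℂ) ∘ (algebraMap ℚ ℝ : ℚ → ℝ)) = (algebraMap ℚ ℂ : ℚ → ℂ) := by
    funext q
    simp
  rw [auxComplexStructure, auxComplexStructureGL, auxRep, MonoidHom.comp_apply, MonoidHom.comp_apply, coe_conjRect, coe_resGL,
    ← Complex.coe_algebraMap, Matrix.map_mul, Matrix.map_mul, framePR, frameQR, Matrix.map_map, Matrix.map_map, hmaps,
    framePC, frameQC]

/-- `S(z)·res(B_z)_ℂ = i·S(z)` (row by row, ★ `censusRow_vecMul_resMatrix`). [cite: Deligne1979ShimuraVarieties, Prop. 2.3.10 (PDF p. 32)] -/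
theorem censusMatrix_mul_resMatrix (z : BallModel.Ball) :
    censusMatrix M F Φ τ T z.1 *
        (resMatrix (Algebra.TensorProduct.basis ℝ (ratBasis M))
          (((blockGL (ℝ ⊗[ℚ] M) (iPhi M Φ, sPhi M j Φ τ T z) : GL (Fin 1 ⊕ Fin 3) (ℝ ⊗[ℚ] M)) :
            Matrix (Fin 1 ⊕ Fin 3) (Fin 1 ⊕ Fin 3) (ℝ ⊗[ℚ] M)))).map (algebraMap ℝ ℂ) =
      Complex.I • censusMatrix M F Φ τ T z.1 := by
  ext k p
  have h := congrFun (censusRow_vecMul_resMatrix M Φ j τ T ((rowEquiv M F Φ).symm k) z) p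
  simpa only [censusMatrix, Matrix.mul_apply, Matrix.vecMul, dotProduct, Matrix.of_apply, Matrix.smul_apply,
    Pi.smul_apply] using h

/-- **`R(z)·(γ J(z) γ⁻¹)_ℂ = i·R(z)`**: the rows of `R` are left `+i`-eigenrows of the translated complex structure.
[cite: Deligne1979ShimuraVarieties, Prop. 2.3.10 (PDF p. 32)] -/
theorem periodRows_mul_conjJ (γ : GL (Fin g ⊕ Fin g) ℝ) (z : BallModel.Ball) :
    periodRows M F Φ τ T γ z.1 * (conjJ γ (auxComplexStructure F τ Φ T z)).map ((↑) : ℝ → ℂ) =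
      Complex.I • periodRows M F Φ τ T γ z.1 := by
  have hγ : ((γ⁻¹ : GL (Fin g ⊕ Fin g) ℝ) : Matrix (Fin g ⊕ Fin g) (Fin g ⊕ Fin g) ℝ).map ((↑) : ℝ → ℂ) * (γ : Matrix (Fin g ⊕ Fin g) (Fin g ⊕ Fin g) ℝ).map ((↑) : ℝ → ℂ) = 1 := by
    rw [← Complex.coe_algebraMap, ← Matrix.map_mul, ← Units.val_mul, inv_mul_cancel, Units.val_one,
      Matrix.map_one _ (map_zero _) (map_one _)]
  rw [conjJ_def, ← Complex.coe_algebraMap, Matrix.map_mul, Matrix.map_mul, Complex.coe_algebraMap,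
    auxComplexStructure_map_ofReal M F Φ τ T z, periodRows]
  -- `S Q γ⁻¹ · (γ P res Q γ⁻¹) = S (res) Q γ⁻¹ = i S Q γ⁻¹`
  calc censusMatrix M F Φ τ T z.1 * frameQC M F * ((γ⁻¹ : GL (Fin g ⊕ Fin g) ℝ) : Matrix (Fin g ⊕ Fin g) (Fin g ⊕ Fin g) ℝ).map ((↑) : ℝ → ℂ) *
        ((γ : Matrix (Fin g ⊕ Fin g) (Fin g ⊕ Fin g) ℝ).map ((↑) : ℝ → ℂ) * (framePC M F * (resMatrix (Algebra.TensorProduct.basis ℝ (ratBasis M))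
          (((blockGL (ℝ ⊗[ℚ] M) (iPhi M Φ, sPhi M j Φ τ T z) : GL (Fin 1 ⊕ Fin 3) (ℝ ⊗[ℚ] M)) :
            Matrix (Fin 1 ⊕ Fin 3) (Fin 1 ⊕ Fin 3) (ℝ ⊗[ℚ] M)))).map (algebraMap ℝ ℂ) * frameQC M F) *
          ((γ⁻¹ : GL (Fin g ⊕ Fin g) ℝ) : Matrix (Fin g ⊕ Fin g) (Fin g ⊕ Fin g) ℝ).map ((↑) : ℝ → ℂ))
      = censusMatrix M F Φ τ T z.1 * (frameQC M F * ((((γ⁻¹ : GL (Fin g ⊕ Fin g) ℝ) : Matrix (Fin g ⊕ Fin g) (Fin g ⊕ Fin g) ℝ).map ((↑) : ℝ → ℂ) *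
          (γ : Matrix (Fin g ⊕ Fin g) (Fin g ⊕ Fin g) ℝ).map ((↑) : ℝ → ℂ)) * framePC M F)) *
          (resMatrix (Algebra.TensorProduct.basis ℝ (ratBasis M))
            (((blockGL (ℝ ⊗[ℚ] M) (iPhi M Φ, sPhi M j Φ τ T z) : GL (Fin 1 ⊕ Fin 3) (ℝ ⊗[ℚ] M)) :
              Matrix (Fin 1 ⊕ Fin 3) (Fin 1 ⊕ Fin 3) (ℝ ⊗[ℚ] M)))).map (algebraMap ℝ ℂ) *
          frameQC M F * ((γ⁻¹ : GL (Fin g ⊕ Fin g) ℝ) : Matrix (Fin g ⊕ Fin g) (Fin g ⊕ Fin g) ℝ).map ((↑) : ℝ → ℂ) := by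
        simp only [Matrix.mul_assoc]
    _ = Complex.I • (censusMatrix M F Φ τ T z.1 * frameQC M F * ((γ⁻¹ : GL (Fin g ⊕ Fin g) ℝ) : Matrix (Fin g ⊕ Fin g) (Fin g ⊕ Fin g) ℝ).map ((↑) : ℝ → ℂ)) := by
        rw [hγ, Matrix.one_mul, frameQC_mul_framePC, Matrix.mul_one, censusMatrix_mul_resMatrix, Matrix.smul_mul,
          Matrix.smul_mul]

/-- **The rows of `R(u)` are linearly independent** (for every `u`): `S(u) = R(u)·(γ_ℂ P_ℂ)` has independent rows
(★ `linearIndependent_censusRow`). [cite: Deligne1979ShimuraVarieties, Prop. 2.3.10 (PDF p. 32)] -/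
theorem periodRows_vecMul_injective (γ : GL (Fin g ⊕ Fin g) ℝ) (u : Fin 2 → ℂ) :
    Function.Injective (periodRows M F Φ τ T γ u).vecMul := by
  have hS : Function.Injective (censusMatrix M F Φ τ T u).vecMul := by
    rw [Matrix.vecMul_injective_iff]
    have h := (linearIndependent_censusRow M Φ j τ T u).comp (rowEquiv M F Φ).symm (rowEquiv M F Φ).symm.injective
    exact h
  intro x y hxy
  apply hS
  have := congrArg (fun v => v ᵥ* ((γ : Matrix (Fin g ⊕ Fin g) (Fin g ⊕ Fin g) ℝ).map ((↑) : ℝ → ℂ) * framePC M F)) hxy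
  simpa only [Matrix.vecMul_vecMul, periodRows_mul] using this

/-! ### §3. The period matrix `Z(u) = Δ·R₂(u)⁻¹·R₁(u)` and its coordinates -/

/-- **`Z(u) = Δ_ℂ·R₂(u)⁻¹·R₁(u)`** (a rational function of `u ∈ ℂ²`). [cite: Lange2023AbelianVarietiesComplex, §7.1.2 (7.3)] -/
def periodZ (γ : GL (Fin g ⊕ Fin g) ℝ) (u : Fin 2 → ℂ) : Matrix (Fin g) (Fin g) ℂ :=
  (Matrix.diagonal fun i => (δ i : ℂ)) * (periodRows M F Φ τ T γ u).toCols₂⁻¹ * (periodRows M F Φ τ T γ u).toCols₁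

/-- **`Z(z) = Z(γ J(z) γ⁻¹)`** when `γ J(z) γ⁻¹ ∈ S⁺` (★ `siegelOfJ_eq_of_leftEigenrows`).
[cite: Lange2023AbelianVarietiesComplex, §7.1.2 (7.3) and Lemma 7.1.6 (1)] -/
theorem periodZ_eq_siegelOfJ (hδ : ∀ i, 0 < δ i) (γ : GL (Fin g ⊕ Fin g) ℝ) (z : BallModel.Ball)
    (hC0 : conjJ γ (auxComplexStructure F τ Φ T z) ∈ C0 δ) :
    periodZ M F Φ τ T γ z.1 = siegelOfJ δ (conjJ γ (auxComplexStructure F τ Φ T z)) := by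
  rw [periodZ, siegelOfJ_eq_of_leftEigenrows hδ hC0 (periodRows M F Φ τ T γ z.1) (periodRows_mul_conjJ M F Φ τ T γ z)
    (periodRows_vecMul_injective M F Φ τ T γ z.1)]

/-- `R₂(z)` is invertible on the ball. [cite: Lange2023AbelianVarietiesComplex, §7.1.2 (7.3)] -/
theorem isUnit_periodRows_toCols₂ (hδ : ∀ i, 0 < δ i) (γ : GL (Fin g ⊕ Fin g) ℝ) (z : BallModel.Ball)
    (hC0 : conjJ γ (auxComplexStructure F τ Φ T z) ∈ C0 δ) :
    IsUnit (periodRows M F Φ τ T γ z.1).toCols₂ :=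
  isUnit_toCols₂_of_vecMul_injective hδ hC0 _ (periodRows_mul_conjJ M F Φ τ T γ z) (periodRows_vecMul_injective M F Φ τ T γ z.1)

/-- **The period point in Klingen coordinates** `ℂ^{g(g+1)/2}`: the symmetrised coordinates `s(i,k) ↦ (Z_{ik} + Z_{ki})/2` of
`Z(u)` (equal to the coordinates of `Z(u)` where `Z(u)` is symmetric, i.e. on the ball). [cite: Deligne1971TravauxShimura, 1.14] -/
def periodCoord (γ : GL (Fin g ⊕ Fin g) ℝ) (u : Fin 2 → ℂ) : Sym2 (Fin g) → ℂ :=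
  fun s => Sym2.lift ⟨fun i k => (periodZ M F Φ τ T γ u i k + periodZ M F Φ τ T γ u k i) / 2,
    fun i k => by ring⟩ s

/-- The symmetrised coordinates of a SYMMETRIC matrix are its Klingen coordinates.
[cite: Klingen1990, Ch. I §1 Def. 2 (p. 2)] -/
theorem coordCLE_symm_symmetrised {A : Matrix (Fin g) (Fin g) ℂ} (hA : A.IsSymm) :
    (((coordCLE g).symm (fun s => Sym2.lift ⟨fun i k => (A i k + A k i) / 2, fun i k => by ring⟩ s) :
      symmetricSubmodule (Fin g) ℂ) : Matrix (Fin g) (Fin g) ℂ) = A := by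
  ext i k
  rw [Literature.NumberTheory.ModularForms.SiegelUpperHalfSpace.coe_coordCLE_symm_apply, Sym2.lift_mk]
  have : A k i = A i k := hA.apply i k
  show (A i k + A k i) / 2 = A i k
  rw [this]
  ring

/-- **On the ball: `Z(z) ∈ 𝔥_g`, its Klingen coordinates are `periodCoord z`, and `γ J(z) γ⁻¹ = J(Z(z))`.**
[cite: Lange2023AbelianVarietiesComplex, §7.1.2 (7.2)–(7.3)] -/
theorem periodCoord_spec (hδ : ∀ i, 0 < δ i) (γ : GL (Fin g ⊕ Fin g) ℝ) (z : BallModel.Ball)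
    (hC0 : conjJ γ (auxComplexStructure F τ Φ T z) ∈ C0 δ) :
    periodCoord M F Φ τ T γ z.1 ∈ siegelUpperHalfSpaceCoord g ∧
      conjJ γ (auxComplexStructure F τ Φ T z) =
        jOfSiegel δ (((coordCLE g).symm (periodCoord M F Φ τ T γ z.1) : symmetricSubmodule (Fin g) ℂ) :
          Matrix (Fin g) (Fin g) ℂ) := by
  have hZ := periodZ_eq_siegelOfJ M F Φ τ T hδ γ z hC0
  have hmem : periodZ M F Φ τ T γ z.1 ∈ siegelUpperHalfSpace g := by rw [hZ]; exact siegelOfJ_mem hC0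
  have hcoe : (((coordCLE g).symm (periodCoord M F Φ τ T γ z.1) : symmetricSubmodule (Fin g) ℂ) :
      Matrix (Fin g) (Fin g) ℂ) = periodZ M F Φ τ T γ z.1 :=
    coordCLE_symm_symmetrised hmem.1
  refine ⟨?_, ?_⟩
  · rw [mem_siegelUpperHalfSpaceCoord_iff, hcoe]; exact hmem
  · rw [hcoe, hZ, jOfSiegel_siegelOfJ hC0 hδ]

/-! ### §4. Holomorphy: `R(u)` is affine in `u`, so `Z = Δ·R₂⁻¹·R₁` is holomorphic where `det R₂ ≠ 0` -/

section MatrixCalculus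

variable {E : Type} [NormedAddCommGroup E] [NormedSpace ℂ E] {m n : Type} [Fintype m] [Fintype n]

omit [Fintype m] in
/-- A matrix-valued map is differentiable iff its entries are. [folklore] -/
private theorem differentiableAt_matrix {A : E → Matrix m n ℂ} {x : E}
    (h : ∀ i k, DifferentiableAt ℂ (fun y => A y i k) x) : DifferentiableAt ℂ A x :=
  differentiableAt_pi.2 fun i => differentiableAt_pi.2 fun k => h i k

omit [Fintype m] in
/-- Entries of a differentiable matrix-valued map are differentiable. [folklore] -/
private theorem differentiableAt_matrix_entry {A : E → Matrix m n ℂ} {x : E}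
    (h : DifferentiableAt ℂ A x) (i : m) (k : n) : DifferentiableAt ℂ (fun y => A y i k) x :=
  differentiableAt_pi.1 (differentiableAt_pi.1 h i) k

omit [Fintype m] in
/-- Products of differentiable matrix-valued maps are differentiable. [folklore] -/
private theorem differentiableAt_matrix_mul {p : Type} [Fintype p] {A : E → Matrix m n ℂ} {B : E → Matrix n p ℂ} {x : E}
    (hA : DifferentiableAt ℂ A x) (hB : DifferentiableAt ℂ B x) :
    DifferentiableAt ℂ (fun y => A y * B y) x :=
  differentiableAt_matrix fun i k => by
    simp only [Matrix.mul_apply]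
    exact DifferentiableAt.fun_sum fun l _ => (differentiableAt_matrix_entry hA i l).mul (differentiableAt_matrix_entry hB l k)

/-- The determinant of a differentiable matrix-valued map is differentiable (Leibniz formula). [folklore] -/
private theorem differentiableAt_matrix_det [DecidableEq n] {A : E → Matrix n n ℂ} {x : E}
    (hA : DifferentiableAt ℂ A x) : DifferentiableAt ℂ (fun y => (A y).det) x := by
  simp only [Matrix.det_apply']
  refine DifferentiableAt.fun_sum fun σ _ => DifferentiableAt.const_mul ?_ _
  exact (HasFDerivAt.finsetProd fun i _ => (differentiableAt_matrix_entry hA (σ i) i).hasFDerivAt).differentiableAt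

/-- The adjugate of a differentiable matrix-valued map is differentiable. [folklore] -/
private theorem differentiableAt_matrix_adjugate [DecidableEq n] {A : E → Matrix n n ℂ} {x : E}
    (hA : DifferentiableAt ℂ A x) : DifferentiableAt ℂ (fun y => (A y).adjugate) x :=
  differentiableAt_matrix fun i k => by
    simp only [Matrix.adjugate_apply]
    refine differentiableAt_matrix_det (differentiableAt_matrix fun k' l => ?_)
    simp only [Matrix.updateRow_apply]
    split_ifs
    · exact differentiableAt_const _
    · exact differentiableAt_matrix_entry hA k' l

/-- The inverse of a differentiable matrix-valued map is differentiable where `det ≠ 0`. [folklore] -/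
private theorem differentiableAt_matrix_inv [DecidableEq n] {A : E → Matrix n n ℂ} {x : E}
    (hA : DifferentiableAt ℂ A x) (hdet : (A x).det ≠ 0) :
    DifferentiableAt ℂ (fun y => (A y)⁻¹) x := by
  have h : (fun y => (A y)⁻¹) = fun y => ((A y).det)⁻¹ • (A y).adjugate := by
    funext y
    rw [Matrix.inv_def, Ring.inverse_eq_inv']
  rw [h]
  exact ((differentiableAt_matrix_det hA).inv hdet).smul (differentiableAt_matrix_adjugate hA)

end MatrixCalculus

/-- The slope matrices `S_a` (`a = 0, 1`) of the affine map `u ↦ S(u)`. [cite: Deligne1979ShimuraVarieties, Prop. 2.3.10 (PDF p. 32)] -/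
def censusSlopeMatrix (a : Fin 2) : Matrix (Fin g) ((Fin 1 ⊕ Fin 3) × Fin (Module.finrank ℚ M)) ℂ :=
  Matrix.of fun k => eigRow M (censusEmb M Φ j τ ((rowEquiv M F Φ).symm k).1 ((rowEquiv M F Φ).symm k).2)
    (censusSlope M Φ j τ T a ((rowEquiv M F Φ).symm k).1 ((rowEquiv M F Φ).symm k).2)

/-- **`S(u) = S(0) + u₀·S_0 + u₁·S_1`.** [cite: Deligne1979ShimuraVarieties, Prop. 2.3.10 (PDF p. 32)] -/
theorem censusMatrix_eq_affine (u : Fin 2 → ℂ) :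
    censusMatrix M F Φ τ T u = censusMatrix M F Φ τ T 0 + (u 0) • censusSlopeMatrix M F Φ τ T 0 +
      (u 1) • censusSlopeMatrix M F Φ τ T 1 := by
  ext k q
  have h := congrFun (censusRow_eq_affine M Φ j τ T ((rowEquiv M F Φ).symm k) u) q
  simpa only [censusMatrix, censusSlopeMatrix, Matrix.of_apply, Matrix.add_apply, Matrix.smul_apply, Pi.add_apply,
    Pi.smul_apply] using h

/-- The slope matrices `R_a = S_a·Q_ℂ·γ⁻¹` of `u ↦ R(u)`. [cite: Deligne1979ShimuraVarieties, Prop. 2.3.10 (PDF p. 32)] -/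
def periodRowsSlope (γ : GL (Fin g ⊕ Fin g) ℝ) (a : Fin 2) : Matrix (Fin g) (Fin g ⊕ Fin g) ℂ :=
  censusSlopeMatrix M F Φ τ T a * frameQC M F *
    ((γ⁻¹ : GL (Fin g ⊕ Fin g) ℝ) : Matrix (Fin g ⊕ Fin g) (Fin g ⊕ Fin g) ℝ).map ((↑) : ℝ → ℂ)

/-- **`R(u) = R(0) + u₀·R_0 + u₁·R_1`.** [cite: Deligne1979ShimuraVarieties, Prop. 2.3.10 (PDF p. 32)] -/
theorem periodRows_eq_affine (γ : GL (Fin g ⊕ Fin g) ℝ) (u : Fin 2 → ℂ) :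
    periodRows M F Φ τ T γ u = periodRows M F Φ τ T γ 0 + (u 0) • periodRowsSlope M F Φ τ T γ 0 +
      (u 1) • periodRowsSlope M F Φ τ T γ 1 := by
  rw [periodRows, periodRows, periodRowsSlope, periodRowsSlope, censusMatrix_eq_affine M F Φ τ T u, Matrix.add_mul,
    Matrix.add_mul, Matrix.add_mul, Matrix.add_mul, Matrix.smul_mul, Matrix.smul_mul, Matrix.smul_mul, Matrix.smul_mul]

/-- `R_a·(γ_ℂ P_ℂ) = S_a`. [cite: Deligne1979ShimuraVarieties, Prop. 2.3.10 (PDF p. 32)] -/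
theorem periodRowsSlope_mul (γ : GL (Fin g ⊕ Fin g) ℝ) (a : Fin 2) :
    periodRowsSlope M F Φ τ T γ a * ((γ : Matrix (Fin g ⊕ Fin g) (Fin g ⊕ Fin g) ℝ).map ((↑) : ℝ → ℂ) * framePC M F) =
      censusSlopeMatrix M F Φ τ T a := by
  have hγ : ((γ⁻¹ : GL (Fin g ⊕ Fin g) ℝ) : Matrix (Fin g ⊕ Fin g) (Fin g ⊕ Fin g) ℝ).map ((↑) : ℝ → ℂ) *
      (γ : Matrix (Fin g ⊕ Fin g) (Fin g ⊕ Fin g) ℝ).map ((↑) : ℝ → ℂ) = 1 := by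
    rw [← Complex.coe_algebraMap, ← Matrix.map_mul, ← Units.val_mul, inv_mul_cancel, Units.val_one,
      Matrix.map_one _ (map_zero _) (map_one _)]
  rw [periodRowsSlope, Matrix.mul_assoc, Matrix.mul_assoc,
    ← Matrix.mul_assoc (((γ⁻¹ : GL (Fin g ⊕ Fin g) ℝ) : Matrix (Fin g ⊕ Fin g) (Fin g ⊕ Fin g) ℝ).map _),
    hγ, Matrix.one_mul, frameQC_mul_framePC, Matrix.mul_one]

/-- **The entries of `R(u)` are affine, with derivative `δ ↦ δ₀·(R_0)_{ic} + δ₁·(R_1)_{ic}`.**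
[cite: Deligne1971TravauxShimura, 1.14] -/
theorem hasFDerivAt_periodRows_apply (γ : GL (Fin g ⊕ Fin g) ℝ) (u₀ : Fin 2 → ℂ) (i : Fin g) (c : Fin g ⊕ Fin g) :
    HasFDerivAt (fun u : Fin 2 → ℂ => periodRows M F Φ τ T γ u i c)
      ((ContinuousLinearMap.proj (R := ℂ) (φ := fun _ : Fin 2 => ℂ) 0).smulRight (periodRowsSlope M F Φ τ T γ 0 i c) +
        (ContinuousLinearMap.proj (R := ℂ) (φ := fun _ : Fin 2 => ℂ) 1).smulRight (periodRowsSlope M F Φ τ T γ 1 i c)) u₀ := by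
  have h : (fun u : Fin 2 → ℂ => periodRows M F Φ τ T γ u i c) = fun u =>
      periodRows M F Φ τ T γ 0 i c + ((ContinuousLinearMap.proj (R := ℂ) (φ := fun _ : Fin 2 => ℂ) 0) u •
        periodRowsSlope M F Φ τ T γ 0 i c +
        (ContinuousLinearMap.proj (R := ℂ) (φ := fun _ : Fin 2 => ℂ) 1) u • periodRowsSlope M F Φ τ T γ 1 i c) := by
    funext u
    rw [periodRows_eq_affine M F Φ τ T γ u]
    simp only [Matrix.add_apply, Matrix.smul_apply, smul_eq_mul, ContinuousLinearMap.proj_apply]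
    ring
  rw [h]
  exact ((((ContinuousLinearMap.proj (R := ℂ) (φ := fun _ : Fin 2 => ℂ) 0).hasFDerivAt).smul_const _).add
    (((ContinuousLinearMap.proj (R := ℂ) (φ := fun _ : Fin 2 => ℂ) 1).hasFDerivAt).smul_const _)).const_add _

/-- `u ↦ R(u)` is differentiable (entries affine). [cite: Deligne1971TravauxShimura, 1.14] -/
theorem differentiableAt_periodRows (γ : GL (Fin g ⊕ Fin g) ℝ) (u₀ : Fin 2 → ℂ) :
    DifferentiableAt ℂ (fun u : Fin 2 → ℂ => periodRows M F Φ τ T γ u) u₀ :=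
  differentiableAt_matrix fun i c => (hasFDerivAt_periodRows_apply M F Φ τ T γ u₀ i c).differentiableAt

/-- **`u ↦ Z(u) = Δ·R₂(u)⁻¹·R₁(u)` is differentiable where `det R₂(u) ≠ 0`.** [cite: Deligne1971TravauxShimura, 1.14] -/
theorem differentiableAt_periodZ (γ : GL (Fin g ⊕ Fin g) ℝ) (u₀ : Fin 2 → ℂ)
    (hdet : ((periodRows M F Φ τ T γ u₀).toCols₂).det ≠ 0) :
    DifferentiableAt ℂ (fun u : Fin 2 → ℂ => periodZ M F Φ τ T γ u) u₀ := by
  have hR := differentiableAt_periodRows M F Φ τ T γ u₀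
  have h2 : DifferentiableAt ℂ (fun u : Fin 2 → ℂ => (periodRows M F Φ τ T γ u).toCols₂) u₀ :=
    differentiableAt_matrix fun i k => differentiableAt_matrix_entry hR i (Sum.inr k)
  have h1 : DifferentiableAt ℂ (fun u : Fin 2 → ℂ => (periodRows M F Φ τ T γ u).toCols₁) u₀ :=
    differentiableAt_matrix fun i k => differentiableAt_matrix_entry hR i (Sum.inl k)
  unfold periodZ
  exact differentiableAt_matrix_mul (differentiableAt_matrix_mul (differentiableAt_const _)
    (differentiableAt_matrix_inv h2 hdet)) h1

/-- `det R₂(z) ≠ 0` on the ball. [cite: Lange2023AbelianVarietiesComplex, §7.1.2 (7.3)] -/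
theorem det_periodRows_toCols₂_ne_zero (hδ : ∀ i, 0 < δ i) (γ : GL (Fin g ⊕ Fin g) ℝ) (z : BallModel.Ball)
    (hC0 : conjJ γ (auxComplexStructure F τ Φ T z) ∈ C0 δ) :
    ((periodRows M F Φ τ T γ z.1).toCols₂).det ≠ 0 := by
  have h := isUnit_periodRows_toCols₂ M F Φ τ T hδ γ z hC0
  rw [Matrix.isUnit_iff_isUnit_det] at h
  exact h.ne_zero

/-- The entries of `Z` are differentiable on the ball. [cite: Deligne1971TravauxShimura, 1.14] -/
theorem differentiableAt_periodZ_apply (hδ : ∀ i, 0 < δ i) (γ : GL (Fin g ⊕ Fin g) ℝ) (z : BallModel.Ball)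
    (hC0 : conjJ γ (auxComplexStructure F τ Φ T z) ∈ C0 δ) (i k : Fin g) :
    DifferentiableAt ℂ (fun u : Fin 2 → ℂ => periodZ M F Φ τ T γ u i k) z.1 :=
  differentiableAt_matrix_entry
    (differentiableAt_periodZ M F Φ τ T γ z.1 (det_periodRows_toCols₂_ne_zero M F Φ τ T hδ γ z hC0)) i k

/-- The Klingen coordinate `s(i,k)` of `periodCoord` is `(Z_{ik} + Z_{ki})/2`. [cite: Klingen1990, Ch. I §1 Def. 2 (p. 2)] -/
theorem periodCoord_apply_mk (γ : GL (Fin g ⊕ Fin g) ℝ) (u : Fin 2 → ℂ) (i k : Fin g) :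
    periodCoord M F Φ τ T γ u s(i, k) = (periodZ M F Φ τ T γ u i k + periodZ M F Φ τ T γ u k i) / 2 := by
  rw [periodCoord, Sym2.lift_mk]

/-- **The period chart is holomorphic on the ball.** [cite: Deligne1971TravauxShimura, 1.14–1.15] -/
theorem differentiableOn_periodCoord (hδ : ∀ i, 0 < δ i) (γ : GL (Fin g ⊕ Fin g) ℝ)
    (hC0 : ∀ x : BallModel.Ball, conjJ γ (auxComplexStructure F τ Φ T x) ∈ C0 δ) :
    DifferentiableOn ℂ (periodCoord M F Φ τ T γ) BallForms.ballSet := by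
  intro w hw
  refine DifferentiableAt.differentiableWithinAt (differentiableAt_pi.2 fun s => ?_)
  induction s using Sym2.ind with
  | h i k =>
    simp only [periodCoord_apply_mk, div_eq_mul_inv]
    have h1 : DifferentiableAt ℂ (fun u : Fin 2 → ℂ => periodZ M F Φ τ T γ u i k) w :=
      differentiableAt_periodZ_apply M F Φ τ T hδ γ ⟨w, hw⟩ (hC0 _) i k
    have h2 : DifferentiableAt ℂ (fun u : Fin 2 → ℂ => periodZ M F Φ τ T γ u k i) w :=
      differentiableAt_periodZ_apply M F Φ τ T hδ γ ⟨w, hw⟩ (hC0 _) k i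
    exact (h1.fun_add h2).mul_const _

/-! ### §5. The differential of the period chart is injective -/

/-- `e₂·reflJ(w) ≠ e₂` for `w = lift z` (`e₂·w = 1 ≠ 0`, and `w̄ᵀJ ≠ 0`). [cite: Deligne1979ShimuraVarieties, Prop. 2.3.10 (PDF p. 32)] -/
theorem single_two_vecMul_reflJ_ne (z : BallModel.Ball) :
    Pi.single (2 : Fin 3) (1 : ℂ) ᵥ* reflJ (BallModel.lift z) ≠ Pi.single 2 1 := by
  intro h
  have hq := formJ_lift_ne_zero z
  rw [reflJ, projJ, Matrix.vecMul_sub, Matrix.vecMul_one, Matrix.vecMul_smul, Matrix.vecMul_smul,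
    Matrix.vecMul_vecMulVec, sub_eq_self] at h
  have h2 := congrFun h 2
  have hdot : Pi.single (2 : Fin 3) (1 : ℂ) ⬝ᵥ BallModel.lift z = 1 := by
    simp [BallModel.lift]
  rw [hdot] at h2
  simp [BallModel.lift, BallModel.J, Matrix.vecMul_diagonal] at h2
  exact hq h2

omit [IsCMField M] in
/-- Every embedding `τ : L → ℂ` extends along `j : L → M` (`M/L` algebraic, `ℂ` algebraically closed). [folklore] -/
private theorem exists_comp_eq_of_ringHom (j' : L →+* M) (τ' : L →+* ℂ) : ∃ ρ : M →+* ℂ, ρ.comp j' = τ' := by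
  -- adapted from Literature/AlgebraicGeometry/Pohlmann1968/SimpleCMFourfoldWeilType.lean (private there)
  letI : Algebra L M := j'.toAlgebra
  letI : Algebra L ℂ := τ'.toAlgebra
  haveI : CharZero L := j'.charZero
  haveI : IsScalarTower ℚ L M := IsScalarTower.of_algebraMap_eq fun x => (map_ratCast j' x).symm
  haveI : Algebra.IsAlgebraic L M := Algebra.IsAlgebraic.tower_top (K := ℚ) L
  let ψ : M →ₐ[L] ℂ := IsAlgClosed.lift
  exact ⟨ψ.toRingHom, ψ.comp_algebraMap⟩

/-- **Step 1.** If `dP_w(δ) = 0` then every entry of `Z` has zero `δ`-derivative at `w` (`Z` is symmetric on the open ball,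
and `P` carries the symmetrised entries). [cite: Deligne1971TravauxShimura, 1.14] -/
theorem fderiv_periodZ_apply_eq_zero (hδ : ∀ i, 0 < δ i) (γ : GL (Fin g ⊕ Fin g) ℝ)
    (hC0 : ∀ x : BallModel.Ball, conjJ γ (auxComplexStructure F τ Φ T x) ∈ C0 δ) {w : Fin 2 → ℂ}
    (hw : w ∈ BallForms.ballSet) {v : Fin 2 → ℂ} (hv : fderiv ℂ (periodCoord M F Φ τ T γ) w v = 0) (m k : Fin g) :
    fderiv ℂ (fun u : Fin 2 → ℂ => periodZ M F Φ τ T γ u m k) w v = 0 := by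
  have hdiff : ∀ a b : Fin g, DifferentiableAt ℂ (fun u : Fin 2 → ℂ => periodZ M F Φ τ T γ u a b) w :=
    fun a b => differentiableAt_periodZ_apply M F Φ τ T hδ γ ⟨w, hw⟩ (hC0 _) a b
  -- symmetric part: the coordinate `s(m,k)` of `P`
  have hP : DifferentiableAt ℂ (periodCoord M F Φ τ T γ) w :=
    (differentiableOn_periodCoord M F Φ τ T hδ γ hC0 w hw).differentiableAt
      (BallForms.isOpen_ballSet.mem_nhds hw)
  have hsym : fderiv ℂ (fun u : Fin 2 → ℂ => periodZ M F Φ τ T γ u m k) w v +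
      fderiv ℂ (fun u : Fin 2 → ℂ => periodZ M F Φ τ T γ u k m) w v = 0 := by
    have h1 : (fun u : Fin 2 → ℂ => periodCoord M F Φ τ T γ u s(m, k)) = fun u =>
        (periodZ M F Φ τ T γ u m k + periodZ M F Φ τ T γ u k m) * (2 : ℂ)⁻¹ := by
      funext u; rw [periodCoord_apply_mk, div_eq_mul_inv]
    have h2 : fderiv ℂ (fun u : Fin 2 → ℂ => periodCoord M F Φ τ T γ u s(m, k)) w v = 0 := by
      rw [fderiv_apply hP s(m, k)]
      simp [hv]
    rw [h1, fderiv_mul_const ((hdiff m k).fun_add (hdiff k m)), fderiv_fun_add (hdiff m k) (hdiff k m)] at h2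
    have h3 : (2 : ℂ)⁻¹ * fderiv ℂ (fun u : Fin 2 → ℂ => periodZ M F Φ τ T γ u m k) w v +
        (2 : ℂ)⁻¹ * fderiv ℂ (fun u : Fin 2 → ℂ => periodZ M F Φ τ T γ u k m) w v = 0 := by
      simpa using h2
    linear_combination (2 : ℂ) * h3
  -- antisymmetric part vanishes on the ball
  have hanti : fderiv ℂ (fun u : Fin 2 → ℂ => periodZ M F Φ τ T γ u m k) w v -
      fderiv ℂ (fun u : Fin 2 → ℂ => periodZ M F Φ τ T γ u k m) w v = 0 := by
    have hev : (fun u : Fin 2 → ℂ => periodZ M F Φ τ T γ u m k - periodZ M F Φ τ T γ u k m) =ᶠ[𝓝 w]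
        fun _ => (0 : ℂ) := by
      filter_upwards [BallForms.isOpen_ballSet.mem_nhds hw] with u hu
      have hZ := periodZ_eq_siegelOfJ M F Φ τ T hδ γ ⟨u, hu⟩ (hC0 _)
      have hsymm : (periodZ M F Φ τ T γ u).IsSymm := by
        have := (siegelOfJ_mem (hC0 ⟨u, hu⟩)).1
        rw [← hZ] at this; exact this
      rw [hsymm.apply m k, sub_self]
    have h := hev.fderiv_eq (𝕜 := ℂ)
    rw [fderiv_fun_sub (hdiff m k) (hdiff k m), fderiv_fun_const] at h
    have h' := congrArg (fun L : (Fin 2 → ℂ) →L[ℂ] ℂ => L v) h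
    simpa using h'
  have : (2 : ℂ) * fderiv ℂ (fun u : Fin 2 → ℂ => periodZ M F Φ τ T γ u m k) w v = 0 := by
    linear_combination hsym + hanti
  simpa using this

/-- **Step 2.** On the ball, `R₁(u)_{ik} = Σ_l R₂(u)_{il}·(Δ⁻¹Z(u))_{lk}` (★ `toCols₁_eq_toCols₂_mul`).
[cite: Lange2023AbelianVarietiesComplex, §7.1.2 (7.3)] -/
theorem periodRows_inl_eq_sum (hδ : ∀ i, 0 < δ i) (γ : GL (Fin g ⊕ Fin g) ℝ) (z : BallModel.Ball)
    (hC0 : conjJ γ (auxComplexStructure F τ Φ T z) ∈ C0 δ) (i k : Fin g) :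
    periodRows M F Φ τ T γ z.1 i (Sum.inl k) = ∑ l, periodRows M F Φ τ T γ z.1 i (Sum.inr l) *
      ((Matrix.diagonal fun i => (δ i : ℂ))⁻¹ * periodZ M F Φ τ T γ z.1) l k := by
  have h := toCols₁_eq_toCols₂_mul hδ hC0 (periodRows M F Φ τ T γ z.1) (periodRows_mul_conjJ M F Φ τ T γ z)
  rw [← periodZ_eq_siegelOfJ M F Φ τ T hδ γ z hC0, Matrix.mul_assoc] at h
  have h2 := congrFun (congrFun h i) k
  rw [Matrix.toCols₁_apply] at h2
  rw [h2, Matrix.mul_apply]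
  rfl

/-- **Step 3.** If `dP_w(δ) = 0` then the derivative `D = δ₀R_0 + δ₁R_1` of `R` satisfies `D₁ = D₂·Δ⁻¹·Z(w)`.
[cite: Deligne1971TravauxShimura, 1.14] -/
theorem slope_toCols₁_eq (hδ : ∀ i, 0 < δ i) (γ : GL (Fin g ⊕ Fin g) ℝ)
    (hC0 : ∀ x : BallModel.Ball, conjJ γ (auxComplexStructure F τ Φ T x) ∈ C0 δ) {w : Fin 2 → ℂ}
    (hw : w ∈ BallForms.ballSet) {v : Fin 2 → ℂ} (hv : fderiv ℂ (periodCoord M F Φ τ T γ) w v = 0) :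
    (v 0 • periodRowsSlope M F Φ τ T γ 0 + v 1 • periodRowsSlope M F Φ τ T γ 1).toCols₁ =
      (v 0 • periodRowsSlope M F Φ τ T γ 0 + v 1 • periodRowsSlope M F Φ τ T γ 1).toCols₂ *
        ((Matrix.diagonal fun i => (δ i : ℂ))⁻¹ * periodZ M F Φ τ T γ w) := by
  ext i k
  rw [Matrix.toCols₁_apply, Matrix.mul_apply]
  simp only [Matrix.toCols₂_apply]
  -- the two functions `R₁(u)_{ik}` and `Σ_l R₂(u)_{il} W(u)_{lk}` agree near `w`
  have hW : ∀ l, DifferentiableAt ℂ (fun u : Fin 2 → ℂ =>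
      ((Matrix.diagonal fun i => (δ i : ℂ))⁻¹ * periodZ M F Φ τ T γ u) l k) w := by
    intro l
    simp only [Matrix.mul_apply]
    exact DifferentiableAt.fun_sum fun m _ =>
      (differentiableAt_periodZ_apply M F Φ τ T hδ γ ⟨w, hw⟩ (hC0 _) m k).const_mul _
  have hW0 : ∀ l, fderiv ℂ (fun u : Fin 2 → ℂ =>
      ((Matrix.diagonal fun i => (δ i : ℂ))⁻¹ * periodZ M F Φ τ T γ u) l k) w v = 0 := by
    intro l
    simp only [Matrix.mul_apply]
    rw [fderiv_fun_sum fun m _ => (differentiableAt_periodZ_apply M F Φ τ T hδ γ ⟨w, hw⟩ (hC0 _) m k).const_mul _]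
    simp only [_root_.sum_apply]
    refine Finset.sum_eq_zero fun m _ => ?_
    rw [fderiv_const_mul (differentiableAt_periodZ_apply M F Φ τ T hδ γ ⟨w, hw⟩ (hC0 _) m k)]
    simp [fderiv_periodZ_apply_eq_zero M F Φ τ T hδ γ hC0 hw hv m k]
  have hR := fun c => hasFDerivAt_periodRows_apply M F Φ τ T γ w i c
  -- derivative of the right-hand side
  have hrhs : HasFDerivAt (fun u : Fin 2 → ℂ => ∑ l, periodRows M F Φ τ T γ u i (Sum.inr l) *
      ((Matrix.diagonal fun i => (δ i : ℂ))⁻¹ * periodZ M F Φ τ T γ u) l k)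
      (∑ l, (periodRows M F Φ τ T γ w i (Sum.inr l) •
        fderiv ℂ (fun u : Fin 2 → ℂ => ((Matrix.diagonal fun i => (δ i : ℂ))⁻¹ * periodZ M F Φ τ T γ u) l k) w +
        ((Matrix.diagonal fun i => (δ i : ℂ))⁻¹ * periodZ M F Φ τ T γ w) l k •
          ((ContinuousLinearMap.proj (R := ℂ) (φ := fun _ : Fin 2 => ℂ) 0).smulRight
              (periodRowsSlope M F Φ τ T γ 0 i (Sum.inr l)) +
            (ContinuousLinearMap.proj (R := ℂ) (φ := fun _ : Fin 2 => ℂ) 1).smulRight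
              (periodRowsSlope M F Φ τ T γ 1 i (Sum.inr l))))) w :=
    HasFDerivAt.fun_sum fun l _ => (hR (Sum.inr l)).fun_mul (hW l).hasFDerivAt
  have hev : (fun u : Fin 2 → ℂ => periodRows M F Φ τ T γ u i (Sum.inl k)) =ᶠ[𝓝 w]
      fun u => ∑ l, periodRows M F Φ τ T γ u i (Sum.inr l) *
        ((Matrix.diagonal fun i => (δ i : ℂ))⁻¹ * periodZ M F Φ τ T γ u) l k := by
    filter_upwards [BallForms.isOpen_ballSet.mem_nhds hw] with u hu
    exact periodRows_inl_eq_sum M F Φ τ T hδ γ ⟨u, hu⟩ (hC0 _) i k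
  have huniq := (hR (Sum.inl k)).unique (hrhs.congr_of_eventuallyEq hev)
  have h := congrArg (fun L : (Fin 2 → ℂ) →L[ℂ] ℂ => L v) huniq
  simp only [_root_.add_apply, ContinuousLinearMap.smulRight_apply, ContinuousLinearMap.proj_apply,
    _root_.sum_apply, _root_.smul_apply, hW0, smul_eq_mul] at h
  rw [Matrix.add_apply, Matrix.smul_apply, Matrix.smul_apply, smul_eq_mul, smul_eq_mul, h]
  refine Finset.sum_congr rfl fun l _ => ?_
  simp only [Matrix.add_apply, Matrix.smul_apply, smul_eq_mul]
  ring

/-- **Step 4.** If `dP_w(δ) = 0` then `D·(γ J(w) γ⁻¹)_ℂ = i·D` for the derivative `D = δ₀R_0 + δ₁R_1` of `R`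
(`D = D₂Δ⁻¹·(Z(w), Δ)` and (7.3)). [cite: Lange2023AbelianVarietiesComplex, §7.1.2 (7.3)] -/
theorem slope_mul_conjJ (hδ : ∀ i, 0 < δ i) (γ : GL (Fin g ⊕ Fin g) ℝ)
    (hC0 : ∀ x : BallModel.Ball, conjJ γ (auxComplexStructure F τ Φ T x) ∈ C0 δ) {w : Fin 2 → ℂ}
    (hw : w ∈ BallForms.ballSet) {v : Fin 2 → ℂ} (hv : fderiv ℂ (periodCoord M F Φ τ T γ) w v = 0) :
    (v 0 • periodRowsSlope M F Φ τ T γ 0 + v 1 • periodRowsSlope M F Φ τ T γ 1) *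
        (conjJ γ (auxComplexStructure F τ Φ T ⟨w, hw⟩)).map ((↑) : ℝ → ℂ) =
      Complex.I • (v 0 • periodRowsSlope M F Φ τ T γ 0 + v 1 • periodRowsSlope M F Φ τ T γ 1) := by
  have hZ := periodZ_eq_siegelOfJ M F Φ τ T hδ γ ⟨w, hw⟩ (hC0 _)
  have hmem : periodZ M F Φ τ T γ w ∈ siegelUpperHalfSpace g := by
    have := siegelOfJ_mem (hC0 ⟨w, hw⟩); rw [← hZ] at this; exact this
  have hY : IsUnit ((periodZ M F Φ τ T γ w).map im).det := (Matrix.isUnit_iff_isUnit_det _).1 hmem.2.isUnit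
  have hJ' : conjJ γ (auxComplexStructure F τ Φ T ⟨w, hw⟩) = jOfSiegel δ (periodZ M F Φ τ T γ w) := by
    have h := hZ
    simp only at h
    rw [h, jOfSiegel_siegelOfJ (hC0 _) hδ]
  have hD : (v 0 • periodRowsSlope M F Φ τ T γ 0 + v 1 • periodRowsSlope M F Φ τ T γ 1) =
      (v 0 • periodRowsSlope M F Φ τ T γ 0 + v 1 • periodRowsSlope M F Φ τ T γ 1).toCols₂ *
        (Matrix.diagonal fun i => (δ i : ℂ))⁻¹ * siegelPeriodMatrix δ (periodZ M F Φ τ T γ w) := by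
    rw [siegelPeriodMatrix_eq_fromCols, Matrix.mul_fromCols, Matrix.mul_assoc, ← slope_toCols₁_eq M F Φ τ T hδ γ hC0 hw hv,
      Matrix.mul_assoc, Matrix.nonsing_inv_mul _ (isUnit_det_diagonal_delta hδ), Matrix.mul_one, Matrix.fromCols_toCols]
  rw [hJ', hD, Matrix.mul_assoc, siegelPeriodMatrix_mul_jOfSiegel hδ hY, Matrix.mul_smul]

/-- **Step 5.** If `dP_w(δ) = 0` then `D_S = δ₀S_0 + δ₁S_1` satisfies `D_S·res(B_w)_ℂ = i·D_S`.
[cite: Deligne1979ShimuraVarieties, Prop. 2.3.10 (PDF p. 32)] -/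
theorem slopeS_mul_resMatrix (hδ : ∀ i, 0 < δ i) (γ : GL (Fin g ⊕ Fin g) ℝ)
    (hC0 : ∀ x : BallModel.Ball, conjJ γ (auxComplexStructure F τ Φ T x) ∈ C0 δ) {w : Fin 2 → ℂ}
    (hw : w ∈ BallForms.ballSet) {v : Fin 2 → ℂ} (hv : fderiv ℂ (periodCoord M F Φ τ T γ) w v = 0) :
    (v 0 • censusSlopeMatrix M F Φ τ T 0 + v 1 • censusSlopeMatrix M F Φ τ T 1) *
        (resMatrix (Algebra.TensorProduct.basis ℝ (ratBasis M))
          (((blockGL (ℝ ⊗[ℚ] M) (iPhi M Φ, sPhi M j Φ τ T ⟨w, hw⟩) : GL (Fin 1 ⊕ Fin 3) (ℝ ⊗[ℚ] M)) :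
            Matrix (Fin 1 ⊕ Fin 3) (Fin 1 ⊕ Fin 3) (ℝ ⊗[ℚ] M)))).map (algebraMap ℝ ℂ) =
      Complex.I • (v 0 • censusSlopeMatrix M F Φ τ T 0 + v 1 • censusSlopeMatrix M F Φ τ T 1) := by
  have hγ : ((γ⁻¹ : GL (Fin g ⊕ Fin g) ℝ) : Matrix (Fin g ⊕ Fin g) (Fin g ⊕ Fin g) ℝ).map ((↑) : ℝ → ℂ) *
      (γ : Matrix (Fin g ⊕ Fin g) (Fin g ⊕ Fin g) ℝ).map ((↑) : ℝ → ℂ) = 1 := by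
    rw [← Complex.coe_algebraMap, ← Matrix.map_mul, ← Units.val_mul, inv_mul_cancel, Units.val_one,
      Matrix.map_one _ (map_zero _) (map_one _)]
  have hDS : (v 0 • censusSlopeMatrix M F Φ τ T 0 + v 1 • censusSlopeMatrix M F Φ τ T 1) =
      (v 0 • periodRowsSlope M F Φ τ T γ 0 + v 1 • periodRowsSlope M F Φ τ T γ 1) *
        ((γ : Matrix (Fin g ⊕ Fin g) (Fin g ⊕ Fin g) ℝ).map ((↑) : ℝ → ℂ) * framePC M F) := by
    rw [Matrix.add_mul, Matrix.smul_mul, Matrix.smul_mul, periodRowsSlope_mul, periodRowsSlope_mul]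
  have h4 := slope_mul_conjJ M F Φ τ T hδ γ hC0 hw hv
  rw [conjJ_def, ← Complex.coe_algebraMap, Matrix.map_mul, Matrix.map_mul, Complex.coe_algebraMap,
    auxComplexStructure_map_ofReal M F Φ τ T ⟨w, hw⟩] at h4
  -- multiply `h4` on the right by `γ_ℂ P_ℂ`
  rw [hDS, ← Matrix.smul_mul, ← h4]
  simp only [Matrix.mul_assoc]
  rw [← Matrix.mul_assoc (((γ⁻¹ : GL (Fin g ⊕ Fin g) ℝ) : Matrix (Fin g ⊕ Fin g) (Fin g ⊕ Fin g) ℝ).map ((↑) : ℝ → ℂ)),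
    hγ, Matrix.one_mul, frameQC_mul_framePC, Matrix.mul_one]

omit [NumberField M] [IsCMField M] in
/-- `(a·(-e₂T⁻¹))·(T r_w T⁻¹) = a·(-e₂T⁻¹)` forces `a = 0` (`e₂·r_w ≠ e₂`, ★ `single_two_vecMul_reflJ_ne`).
[cite: Deligne1979ShimuraVarieties, Prop. 2.3.10 (PDF p. 32)] -/
theorem eq_zero_of_smul_row_vecMul_reflFrame (a : ℂ) (z : BallModel.Ball)
    (h : (a • (-(Pi.single (2 : Fin 3) (1 : ℂ) ᵥ* ((T⁻¹ : GL (Fin 3) ℂ) : Matrix (Fin 3) (Fin 3) ℂ)))) ᵥ*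
        reflFrame T (BallModel.lift z) =
      a • (-(Pi.single (2 : Fin 3) (1 : ℂ) ᵥ* ((T⁻¹ : GL (Fin 3) ℂ) : Matrix (Fin 3) (Fin 3) ℂ)))) : a = 0 := by
  by_contra ha
  apply single_two_vecMul_reflJ_ne z
  simp only [Matrix.smul_vecMul, Matrix.neg_vecMul, smul_neg, neg_inj] at h
  have h1 : (Pi.single (2 : Fin 3) (1 : ℂ) ᵥ* ((T⁻¹ : GL (Fin 3) ℂ) : Matrix (Fin 3) (Fin 3) ℂ)) ᵥ*
      reflFrame T (BallModel.lift z) = Pi.single (2 : Fin 3) (1 : ℂ) ᵥ* ((T⁻¹ : GL (Fin 3) ℂ) : Matrix (Fin 3) (Fin 3) ℂ) :=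
    smul_right_injective (Fin 3 → ℂ) ha h
  have hTi : ((T⁻¹ : GL (Fin 3) ℂ) : Matrix (Fin 3) (Fin 3) ℂ) * (T : Matrix (Fin 3) (Fin 3) ℂ) = 1 := by
    rw [← Units.val_mul, inv_mul_cancel, Units.val_one]
  rw [reflFrame, Matrix.vecMul_vecMul, ← Matrix.mul_assoc, ← Matrix.mul_assoc, hTi, Matrix.one_mul] at h1
  have h2 := congrArg (fun r => r ᵥ* (T : Matrix (Fin 3) (Fin 3) ℂ)) h1
  simp only [Matrix.vecMul_vecMul, Matrix.mul_assoc, hTi, Matrix.mul_one, Matrix.vecMul_one] at h2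
  exact h2

/-- Converse of ★ `vecMul_fromBlocks_I_of_vecMul_eq`: `(0 | c')·diag(i, iS) = i(0 | c')` forces `c'S = c'`.
[cite: Deligne1979ShimuraVarieties, Prop. 2.3.10 (PDF p. 32)] -/
theorem vecMul_eq_of_vecMul_fromBlocks_I {S : Matrix (Fin 3) (Fin 3) ℂ} {c' : Fin 3 → ℂ}
    (h : Sum.elim (0 : Fin 1 → ℂ) c' ᵥ* Matrix.fromBlocks (Complex.I • (1 : Matrix (Fin 1) (Fin 1) ℂ)) 0 0 (Complex.I • S) =
      Complex.I • Sum.elim (0 : Fin 1 → ℂ) c') : c' ᵥ* S = c' := by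
  rw [Matrix.vecMul_fromBlocks, Sum.elim_comp_inl, Sum.elim_comp_inr, Matrix.zero_vecMul, Matrix.zero_vecMul,
    Matrix.vecMul_zero, zero_add, Matrix.vecMul_smul] at h
  funext i
  have := congrFun h (Sum.inr i)
  simp only [Sum.elim_inr, zero_add, Pi.smul_apply, smul_eq_mul] at this
  exact mul_left_cancel₀ Complex.I_ne_zero this

/-- **Step 6 — the differential of the period chart is injective on the ball.**  With `ρ₀ ∈ Φ` over `τ` (it exists, and
lies in `Φ` by `IsExtAdapted`), the `(ρ₀, inr a)`-row of `D_S` is `δ_a·(0 | -e₂T⁻¹) ⊗ r_{ρ₀}`; Step 5 makes it a left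
`+i`-eigenrow of `res(B_w)_ℂ`, hence (★ `vecMul_map_eq_smul_of_eigRow_vecMul_resMatrix`, E1) `δ_a·(-e₂T⁻¹)` is fixed by
`T r_w T⁻¹`, so `δ_a = 0`. [cite: Deligne1971TravauxShimura, 1.14–1.15] -/
theorem injective_fderiv_periodCoord (hδ : ∀ i, 0 < δ i) (γ : GL (Fin g ⊕ Fin g) ℝ)
    (hC0 : ∀ x : BallModel.Ball, conjJ γ (auxComplexStructure F τ Φ T x) ∈ C0 δ) (hΦ : IsExtAdapted τ j Φ)
    {w : Fin 2 → ℂ} (hw : w ∈ BallForms.ballSet) :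
    Function.Injective (fderiv ℂ (periodCoord M F Φ τ T γ) w) := by
  obtain ⟨ρ, hρ⟩ := exists_comp_eq_of_ringHom M j τ
  have hρΦ : ρ ∈ Φ.1 := hΦ ρ hρ
  rw [injective_iff_map_eq_zero]
  intro v hv
  have h5 := slopeS_mul_resMatrix M F Φ τ T hδ γ hC0 hw hv
  -- the row of index `(ρ₀, inr a)`
  have key : ∀ a : Fin 2, v a = 0 := by
    intro a
    have hρτ : (⟨ρ, hρΦ⟩ : Φ.1).1.comp j = τ := hρ
    have hne : ¬ ((⟨ρ, hρΦ⟩ : Φ.1).1.comp j = τ ∧ (Sum.inr (Fin.castSucc a) : Fin 1 ⊕ Fin 3) = Sum.inr 2) := by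
      rintro ⟨-, h⟩
      have := Sum.inr_injective h
      fin_cases a <;> simp_all
    have hemb : censusEmb M Φ j τ ⟨ρ, hρΦ⟩ (Sum.inr (Fin.castSucc a)) = ρ := by
      simp only [censusEmb]; rw [if_neg hne]
    have hslope : ∀ b : Fin 2, censusSlope M Φ j τ T b ⟨ρ, hρΦ⟩ (Sum.inr (Fin.castSucc a)) =
        if b = a then Sum.elim (0 : Fin 1 → ℂ)
          (-(Pi.single (2 : Fin 3) (1 : ℂ) ᵥ* ((T⁻¹ : GL (Fin 3) ℂ) : Matrix (Fin 3) (Fin 3) ℂ))) else 0 := by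
      intro b
      simp only [censusSlope]
      rw [if_pos hρτ]
      fin_cases a <;> fin_cases b <;> simp
    -- the row `k₀ = rowEquiv (ρ₀, inr a)` of `D_S`
    have hrow : (v 0 • censusSlopeMatrix M F Φ τ T 0 + v 1 • censusSlopeMatrix M F Φ τ T 1)
        (rowEquiv M F Φ (⟨ρ, hρΦ⟩, Sum.inr (Fin.castSucc a))) =
        eigRow M ρ (Sum.elim (0 : Fin 1 → ℂ)
          ((v a) • (-(Pi.single (2 : Fin 3) (1 : ℂ) ᵥ* ((T⁻¹ : GL (Fin 3) ℂ) : Matrix (Fin 3) (Fin 3) ℂ))))) := by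
      funext q
      simp only [Matrix.add_apply, Matrix.smul_apply, censusSlopeMatrix, Matrix.of_apply, Equiv.symm_apply_apply, hemb,
        hslope, smul_eq_mul]
      obtain ⟨i, l⟩ := q
      fin_cases a <;> rcases i with i | i <;> simp [eigRow] <;> ring
    have heig := congrFun (congrArg (fun X => X (rowEquiv M F Φ (⟨ρ, hρΦ⟩, Sum.inr (Fin.castSucc a)))) h5)
    -- as a `vecMul` statement
    have heig' : eigRow M ρ (Sum.elim (0 : Fin 1 → ℂ)
          ((v a) • (-(Pi.single (2 : Fin 3) (1 : ℂ) ᵥ* ((T⁻¹ : GL (Fin 3) ℂ) : Matrix (Fin 3) (Fin 3) ℂ))))) ᵥ*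
        (resMatrix (Algebra.TensorProduct.basis ℝ (ratBasis M))
          (((blockGL (ℝ ⊗[ℚ] M) (iPhi M Φ, sPhi M j Φ τ T ⟨w, hw⟩) : GL (Fin 1 ⊕ Fin 3) (ℝ ⊗[ℚ] M)) :
            Matrix (Fin 1 ⊕ Fin 3) (Fin 1 ⊕ Fin 3) (ℝ ⊗[ℚ] M)))).map (algebraMap ℝ ℂ) =
        Complex.I • eigRow M ρ (Sum.elim (0 : Fin 1 → ℂ)
          ((v a) • (-(Pi.single (2 : Fin 3) (1 : ℂ) ᵥ* ((T⁻¹ : GL (Fin 3) ℂ) : Matrix (Fin 3) (Fin 3) ℂ))))) := by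
      rw [← hrow]
      funext q
      have := heig q
      simpa only [Matrix.mul_apply, Matrix.vecMul, dotProduct, Matrix.smul_apply, Pi.smul_apply, smul_eq_mul] using this
    have hc := vecMul_map_eq_smul_of_eigRow_vecMul_resMatrix M ρ _ heig'
    rw [coe_blockGL_iPhi_sPhi_map_embOf_of_mem M Φ j τ T hρΦ ⟨w, hw⟩, sComp_of_eq _ hρτ] at hc
    exact eq_zero_of_smul_row_vecMul_reflFrame T (v a) ⟨w, hw⟩ (vecMul_eq_of_vecMul_fromBlocks_I hc)
  funext a
  exact key a

/-! ### §6. The export: the period chart in the shape consumed by ★ `S2Imm_of_periodChart` -/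

/-- **The period chart of `J_{β,Φ}` (KEY TARGET 1).**  For every real similitude `γ` with `γ J_{β,Φ}(x) γ⁻¹ ∈ S⁺_δ` on the
ball there is a holomorphic map `P : ℂ² ⊇ 𝔹 → ℂ^{g(g+1)/2}` with injective differential such that `P(x) ∈ 𝔥_g`
(Klingen coordinates) and `γ J_{β,Φ}(x) γ⁻¹ = J(Z)` for `Z` the symmetric matrix with coordinates `P(x)`: namely
`P = coordinates of Δ·R₂⁻¹·R₁` (§§2–5).  [cite: Deligne1971TravauxShimura, 1.14–1.15 and 5.4]
[cite: Deligne1979ShimuraVarieties, Prop. 2.3.10 (PDF p. 32)] -/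
theorem periodChart :
    ∀ (L : Type) [Field L] [NumberField L] [IsCMField L] (H : Matrix (Fin 3) (Fin 3) L) (τ : L →+* ℂ)
      (T : GL (Fin 3) ℂ), formCongr (starRingEnd ℂ) T (H.map τ) = BallModel.J →
      (∀ τ' : L →+* ℂ, InfinitePlace.mk τ' ≠ InfinitePlace.mk τ → (H.map τ').PosDef) →
      ∀ (M : Type) [Field M] [NumberField M] [IsCMField M] (j : L →+* M) (Φ : CMType M), IsExtAdapted τ j Φ →
      ∀ (ξ₀ ξ : M) (g : ℕ) (δ : Fin g → ℕ) (F : SymplecticFrame M j H ξ₀ ξ g δ), IsPolarizationType δ →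
      ∀ γ : ↥(gspReal δ), (∀ x : BallModel.Ball,
        conjJ (γ : GL (Fin g ⊕ Fin g) ℝ) (auxComplexStructure F τ Φ T x) ∈ C0 δ) →
      ∃ P : (Fin 2 → ℂ) → (Sym2 (Fin g) → ℂ), DifferentiableOn ℂ P BallForms.ballSet ∧
        (∀ w ∈ BallForms.ballSet, Function.Injective (fderiv ℂ P w)) ∧
        ∀ x : BallModel.Ball, P x.1 ∈ siegelUpperHalfSpaceCoord g ∧
          conjJ (γ : GL (Fin g ⊕ Fin g) ℝ) (auxComplexStructure F τ Φ T x) =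
            jOfSiegel δ (((coordCLE g).symm (P x.1) : symmetricSubmodule (Fin g) ℂ) : Matrix (Fin g) (Fin g) ℂ) := by
  intro L _ _ _ H τ T _ _ M _ _ _ j Φ hΦ ξ₀ ξ g δ F hδ γ hC0
  have hδ' : ∀ i, 0 < δ i := hδ.1
  exact ⟨periodCoord M F Φ τ T (γ : GL (Fin g ⊕ Fin g) ℝ), differentiableOn_periodCoord M F Φ τ T hδ' _ hC0,
    fun w hw => injective_fderiv_periodCoord M F Φ τ T hδ' _ hC0 hΦ hw,
    fun x => periodCoord_spec M F Φ τ T hδ' _ x (hC0 x)⟩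

end Aux

end UnitaryCanonicalModel

end Literature.AlgebraicGeometry.ShimuraVarieties
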